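import Summits.BirchSwinnertonDyer.Rank1Residual.X11b.AnticyclotomicTowerTorsion
import Literature.NumberTheory.EllipticCurves.IwasawaCoinvariantsRankProofs
import HarnessLib

/-!
# X11b, route R1 — `H¹(K, E[p^∞]) → H¹(K_∞, E[p^∞])` is INJECTIVE on the tower of route R1
# (Greenberg's Lemma 3.1 with `E(K_∞)[p^∞] = 0`: `ker h₀ ≅ H¹(Γ, E(K_∞)[p^∞]) = 0`)

HONEST FRAMING (cell `b2b-bsdres`, run/shared/lean/b2b/bsd-rank1-residual/, verbatim in every
file): the goal of the cell is to DELETE the COMBINATION-SHAPED residual classes of the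
Birch–Swinnerton-Dyer formula for ALL analytic-rank `≤ 1` elliptic curves over `ℚ` — "full BSD
formula for every rank `≤ 1` curve in class `C`" assembled STRICTLY from published theorems — so
that the rank-`≤ 1` remainder becomes exactly the CONSTRUCTION-SHAPED classes, which are TYPED
(missing-input `Prop`s), NOT attempted. This is not "finishing BSD". Sub-cell
`b2b-bsdres-multr1-p1` (X11b, route R1 = Castella 2018 Thm. A re-proved along the author's
erratum); a RESEARCH ROUTE; no claim beyond the stated class; X11b stays CONSTRUCTION-SHAPED;
nothing here changes a label; no named fact is minted (theorems only; no `sorry`).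

## Content

Gen 8 proved `E(K_∞)[p^∞] = E[p^∞]^{Gal(K̄/K_∞)} = 0` for EVERY `ℤ_p`-extension of a quadratic `K`
from `Irr ∧ Ram` (`fixedPoints_kerSubgroup_eq_bot_of_irr_of_ram`, the (glob) hypothesis of the
erratum's Lemma 2.1 on the real tower). The tree's Greenberg Lemma 3.1 machinery
(`ResKernel.finite_subgroupResKer`, `IwasawaCoinvariantsRankProofs`: the kernel of
`res : H¹(G, M) → H¹(N, M)` embeds into `M^N/(γ − 1)M^N` when `N` and `γ` generate `G`
topologically — "`ker(h_n) ≅ H¹(Γ_n, B) = B/(γ^{pⁿ} − 1)B`", LNM 1716 §3 p. 86) turns this into: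

* **`subgroupResKer_kerSubgroup_eq_bot_of_fixedPoints_eq_bot`** (any elliptic `E/K` over a number
  field, any `ℤ_p`-extension `κ`): if `E[p^∞]^{Gal(K̄/K_∞)} = 0` then the kernel of the restriction
  `H¹(K, E[p^∞]) → H¹(K_∞, E[p^∞])` is trivial; `resSubgroup_kerSubgroup_injective_of_fixedPoints_eq_bot`
  (the restriction `ResKernel.resSubgroup` is injective).
* **`resSubgroup_kerSubgroup_injective_of_irr_of_ram`**: for `E/ℚ` with `p ≠ 2`, `Irr W p`, `Ram W p`,
  `K` quadratic and `κ` ANY `ℤ_p`-extension of `K` (in particular the anticyclotomic one):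
  `H¹(K, E[p^∞]) ↪ H¹(K_∞, E[p^∞])`; `ChainLocus.resSubgroup_kerSubgroup_injective(_of_isErratumField)`
  on route R1's population / erratum fields.

This is the first step ("`ker h₀ = 0`") of the control argument for route R1's objects
(Jetchev–Skinner–Wan, arXiv:1512.06894 §3.3.2: "`H¹(𝒦^S/𝒦, W) = H¹(𝒦^S/𝒦, M[γ − 1]) → H¹(𝒦^S/𝒦, M)`
… is an injection" under their `(irr_𝒦)`; Greenberg LNM 1716 Lemma 3.1). Nothing about the local
conditions (the maps `g_n`, Lemma 3.5) or surjectivity (Lemma 3.2) is claimed.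

References: [GreenbergLNM1716] §3 Lemma 3.1 (p. 86); [JetchevSkinnerWan2017] §3.3 (arXiv §3.3.2);
[Castella2018Erratum] Lemma 2.1; [SerreGaloisCohomology1997] I.§2.6 (b).
-/

noncomputable section

open scoped Classical

open WeierstrassCurve NumberField Literature.NumberTheory.EllipticCurves
  Literature.NumberTheory.EllipticCurves.Rank1Residual

universe u

namespace Summit.BirchSwinnertonDyer.Rank1Residual.X11b

/-! ### Generic: trivial `E(K_∞)[p^∞]` ⇒ injective restriction -/

section Generic

variable {K : Type u} [Field K] [NumberField K] (W : WeierstrassCurve K) (p : ℕ) [Fact p.Prime]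
  (κ : ZpExtension K p)

/-- **Greenberg's Lemma 3.1 with `B = 0`.** For an elliptic curve `E/K` over a number field and a
`ℤ_p`-extension `κ` with topological generator `γ`: if `B = E[p^∞]^{Gal(K̄/K_∞)} = E(K_∞)[p^∞]` is
trivial, then the kernel `subgroupResKer E[p^∞] (ker κ)` of the restriction
`H¹(K, E[p^∞]) → H¹(K_∞, E[p^∞])` is trivial: it embeds into `B/(γ − 1)B = 0`
(`ResKernel.finite_subgroupResKer`; `ker κ` and `γ` generate `Γ_K` topologically,
`ZpExtension.eq_top_of_isOpen_of_kerSubgroup_le`). "`ker(h_0) ≅ H¹(Γ, B)`".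
[cite: GreenbergLNM1716, §3 Lemma 3.1 (p. 86)] -/
theorem subgroupResKer_kerSubgroup_eq_bot_of_fixedPoints_eq_bot {γ : Field.absoluteGaloisGroup K}
    (hγ : κ.IsTopGenerator γ)
    (hB : FixedPoints.addSubgroup κ.kerSubgroup (W.geomPrimaryTorsion p) = ⊥) :
    subgroupResKer (W.geomPrimaryTorsion p) κ.kerSubgroup = ⊥ := by
  -- `B/(γ - 1)B` is a quotient of `B = ⊥`: at most one element
  haveI hsub : Subsingleton (FixedPoints.addSubgroup κ.kerSubgroup (W.geomPrimaryTorsion p)) := by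
    rw [hB]; infer_instance
  haveI hfinQ : Finite (FixedPoints.addSubgroup κ.kerSubgroup (W.geomPrimaryTorsion p) ⧸
      (ResKernel.subOne κ.kerSubgroup (W.geomPrimaryTorsion p) γ).range) :=
    Finite.of_surjective _ (QuotientAddGroup.mk'_surjective _)
  have hcardQ : Nat.card (FixedPoints.addSubgroup κ.kerSubgroup (W.geomPrimaryTorsion p) ⧸
      (ResKernel.subOne κ.kerSubgroup (W.geomPrimaryTorsion p) γ).range) ≤ 1 := by
    rw [Finite.card_le_one_iff_subsingleton]
    refine ⟨fun a b ↦ ?_⟩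
    obtain ⟨a, rfl⟩ := QuotientAddGroup.mk'_surjective _ a
    obtain ⟨b, rfl⟩ := QuotientAddGroup.mk'_surjective _ b
    rw [Subsingleton.elim a b]
  -- Greenberg's embedding `ker res ↪ B/(γ - 1)B`
  obtain ⟨hfin, hle⟩ := ResKernel.finite_subgroupResKer κ.kerSubgroup (W.geomPrimaryTorsion p) γ
    (κ.eq_top_of_isOpen_of_kerSubgroup_le hγ) (W.continuous_smul_geomPrimaryTorsion p)
  haveI := hfin
  haveI : Subsingleton (subgroupResKer (W.geomPrimaryTorsion p) κ.kerSubgroup) :=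
    Finite.card_le_one_iff_subsingleton.mp (hle.trans hcardQ)
  exact (subgroupResKer (W.geomPrimaryTorsion p) κ.kerSubgroup).eq_bot_of_subsingleton

/-- **… so the restriction `H¹(K, E[p^∞]) → H¹(K_∞, E[p^∞])` (`ResKernel.resSubgroup`) is injective**
when `E(K_∞)[p^∞] = 0`. [cite: GreenbergLNM1716, §3 Lemma 3.1 (p. 86)] -/
theorem resSubgroup_kerSubgroup_injective_of_fixedPoints_eq_bot {γ : Field.absoluteGaloisGroup K}
    (hγ : κ.IsTopGenerator γ)
    (hB : FixedPoints.addSubgroup κ.kerSubgroup (W.geomPrimaryTorsion p) = ⊥) :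
    Function.Injective (ResKernel.resSubgroup κ.kerSubgroup (W.geomPrimaryTorsion p)) := by
  rw [← AddMonoidHom.ker_eq_bot_iff, ← ResKernel.subgroupResKer_eq_ker]
  exact subgroupResKer_kerSubgroup_eq_bot_of_fixedPoints_eq_bot W p κ hγ hB

end Generic

/-! ### Route R1: `Irr ∧ Ram`, `K` quadratic, any `ℤ_p`-extension -/

section RouteR1

variable (W : WeierstrassCurve ℚ) [W.IsElliptic] [W.IsGloballyMinimal] (p : ℕ) [Fact p.Prime]

/-- **`H¹(K, E[p^∞]) ↪ H¹(K_∞, E[p^∞])` for EVERY `ℤ_p`-extension of a quadratic `K`, from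
`Irr ∧ Ram` (`p ≠ 2`)** — in particular for the anticyclotomic `ℤ_p`-extension of an erratum field:
gen 8's `E(K_∞)[p^∞] = 0` (`fixedPoints_kerSubgroup_eq_bot_of_irr_of_ram`) fed to Lemma 3.1 with
`B = 0`. A topological generator exists for every `κ` (`κ` is surjective). First step of the control
argument for route R1's Selmer groups (JSW17, arXiv:1512.06894 §3.3.2, under `(irr_𝒦)`).
[cite: GreenbergLNM1716, §3 Lemma 3.1 (p. 86)] [cite: JetchevSkinnerWan2017, §3.3 (control; shape only)] [cite: Castella2018Erratum, Lemma 2.1 and Remark p. 2] -/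
theorem resSubgroup_kerSubgroup_injective_of_irr_of_ram (hp2 : p ≠ 2) (hirr : Irr W p)
    (hram : Ram W p) (K : Type) [Field K] [NumberField K] (hK : Module.finrank ℚ K = 2)
    (κ : ZpExtension K p) :
    Function.Injective
      (ResKernel.resSubgroup κ.kerSubgroup ((W.baseChange K).geomPrimaryTorsion p)) := by
  obtain ⟨γ, hγ⟩ := κ.surjective (Multiplicative.ofAdd 1)
  exact resSubgroup_kerSubgroup_injective_of_fixedPoints_eq_bot (W.baseChange K) p κ hγ
    (fixedPoints_kerSubgroup_eq_bot_of_irr_of_ram W p hp2 hirr hram K hK κ)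

/-- **On route R1's population (`ChainLocus`)**, for every quadratic `K` and every `ℤ_p`-extension:
`H¹(K, E[p^∞]) ↪ H¹(K_∞, E[p^∞])`. [cite: GreenbergLNM1716, §3 Lemma 3.1 (p. 86)] [cite: Castella2018Erratum, Thm. A′ (p. 1)] -/
theorem ChainLocus.resSubgroup_kerSubgroup_injective {W : WeierstrassCurve ℚ} [W.IsElliptic]
    [W.IsGloballyMinimal] {p : ℕ} [Fact p.Prime] (h : ChainLocus W p)
    (K : Type) [Field K] [NumberField K] (hK : Module.finrank ℚ K = 2) (κ : ZpExtension K p) :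
    Function.Injective
      (ResKernel.resSubgroup κ.kerSubgroup ((W.baseChange K).geomPrimaryTorsion p)) := by
  obtain ⟨γ, hγ⟩ := κ.surjective (Multiplicative.ofAdd 1)
  exact resSubgroup_kerSubgroup_injective_of_fixedPoints_eq_bot (W.baseChange K) p κ hγ
    (h.fixedPoints_kerSubgroup_eq_bot K hK κ)

/-- **On an erratum field** of route R1 (imaginary quadratic): `H¹(K, E[p^∞]) ↪ H¹(K_∞, E[p^∞])` for
every `ℤ_p`-extension `κ` of `K`. [cite: GreenbergLNM1716, §3 Lemma 3.1 (p. 86)] [cite: Castella2018Erratum, Lemma 2.1 and Thm. 1.1 (i)] -/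
theorem ChainLocus.resSubgroup_kerSubgroup_injective_of_isErratumField {W : WeierstrassCurve ℚ}
    [W.IsElliptic] [W.IsGloballyMinimal] {p : ℕ} [Fact p.Prime] (h : ChainLocus W p) {q : ℕ}
    (K : Type) [Field K] [NumberField K] (hKf : IsErratumField W K q) (κ : ZpExtension K p) :
    Function.Injective
      (ResKernel.resSubgroup κ.kerSubgroup ((W.baseChange K).geomPrimaryTorsion p)) :=
  h.resSubgroup_kerSubgroup_injective K hKf.1.1 κ

end RouteR1

end Summit.BirchSwinnertonDyer.Rank1Residual.X11b

end
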